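import Literature.Algebra.Lie.OrthogonalSelfAdjointIrreducibleTypeD
import HarnessLib

/-!
# The traceless self-adjoint operators `𝔤_+(U) ≅ Λ²₀U` of a SYMPLECTIC space are an IRREDUCIBLE `𝔰𝔭(U)`-module — in matrices and basis-free (Looijenga–Lunts 1997, Appendix (7.5): "The summands are irreducible", the summand `𝔤_+(U)`, `ε = -1`)

Topic `Literature/Algebra/Lie` (namespace `Literature.Algebra.Lie.SymplecticSelfAdjoint`).  Lane `lit-hodgefound`
(Track 2 foundations library), Layer A1, skeleton seat `lit-hodgefound-skel-1` (generation 50), row **A1-176** of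
`run/shared/lean/pub/lit-hodgefound/SKELETON.md` — the symplectic twin of rows A1-174/175
(`OrthogonalSelfAdjointIrreducibleTypeD.lean`, imported: its transport core `eq_bot_or_eq_of_core` is reused verbatim).
THEOREMS ONLY about Mathlib objects (`LieAlgebra.Symplectic.sp l K = 𝔰𝔭(2l, K)` for `Matrix.J l K = (0 -I; I 0)`,
`Matrix.IsSelfAdjoint`, `selfAdjointMatricesSubmodule`, `Matrix.trace`, `LinearMap.BilinForm.selfAdjointSubmodule`,
`LinearMap.trace`); no definition, no named fact, no `sorry` (net debt `0`); no instance, no notation.  Reused: p17's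
`SymplecticSimple.lean` (block form and Humphreys' basis of `𝔰𝔭(2l)`), rows A1-168/169's `OrthogonalSimpleTypeD.lean`
(`comm_comm_eq_of_mul_self_eq_zero`, `msub_comm_nsub`, `sub_transpose_eq_sum_smul` — the units `n_{ab}`, `p_{ab}` of
`𝔬(2l)` ARE the weight vectors of `Λ²`), row A1-166's `SymplecticAlgebraSimple.lean` (Darboux Gram matrix `-J`, bridges)
and the tree's Darboux basis `Literature.LinearAlgebra.Alternating.exists_symplecticBasis`.

## Source, VERBATIM (held TeX `paper:arxiv-alg-geom_9604014`, p0028 L80–L94)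

> "Let `U` be vector space of finite dimension `≥ 2` with a nondegenerate `ε`-symmetric form and denote its Lie algebra
> of infinitesimal automorphisms by `𝔞𝔲𝔱(U)`. Let `𝔤_±(U)` be the set of `x ∈ 𝔰𝔩(U)` satisfying `⟨xu, u'⟩ = ±⟨u, xu'⟩`
> and let `𝔤_0(U)` denote the scalar operators in `𝔤𝔩(U)`.  (7.5) Lemma. Suppose that `U` is not an inner product space
> of dimension two. Then `𝔤𝔩_-(U) = 𝔞𝔲𝔱(U)` and `𝔤𝔩(U) = 𝔤_-(U) ⊕ 𝔤_0(U) ⊕ 𝔤_+(U)` is an `𝔞𝔲𝔱(U)`-invariant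
> decomposition. The summands are irreducible, except when `U` is an inner product space of dimension `4`. […]
> Proof. The first statements are well-known."

Here `ε = -1`: `U` symplectic of dimension `2l`, `𝔞𝔲𝔱(U) = 𝔰𝔭(U)`, `𝔤_+(U) = {X : ⟨Xu, u'⟩ = ⟨u, Xu'⟩, tr X = 0}`
— in a Darboux basis the `(A B; C Aᵀ)` with `B`, `C` ANTISYMMETRIC and `tr A = 0` (`fromBlocks_isSelfAdjoint_J_iff`),
i.e. `Λ²₀U = Λ²U / K·ω`; "irreducible" is rendered as in rows A1-166/171/174: every `K`-subspace `P ⊆ 𝔤_+` stable under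
`X ↦ [a, X]` (`a ∈ 𝔰𝔭(U)`) is `⊥` or `𝔤_+`.  No exception occurs in the symplectic case (for `dim U = 2`, `𝔤_+(U) = 0`,
row A1-163); the statement holds over every field with `2 ≠ 0` and `dim U ≠ 0` in `K` — the latter is necessary (for
`char K ∣ l` the class of `ω`, i.e. the identity of `U`, is traceless and spans a stable line), and is automatic over `ℂ`.

## Proof (the weight calculus of [Humphreys1972, §20.1–§20.2] made elementary; [Humphreys1972, §2 Exercise 6])

The root vectors `E_{ab'} + E_{ba'}`, `E_{a'b} + E_{b'a}` of `𝔰𝔭(2l)` square to zero, so `(ad Y)²X = -2·YXY` puts `YXY`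
into any `ad 𝔰𝔭`-stable `P ∋ X`; for `J`-self-adjoint `X` these sandwiches are SINGLE weight vectors:
`(E_{ab'} + E_{ba'})X(E_{ab'} + E_{ba'}) = X_{b'a} n_{ab}`, `n_{ab} = E_{ab'} - E_{ba'}` (§3).  Hence a non-zero
off-diagonal-block entry of `X ∈ P` gives a unit `n_{ab} ∈ P` (`a ≠ b`; an upper-right entry gives `p_{ab}`, lifted to
`n_{ab}` by `E_{aa'}`, `E_{bb'}`); an upper-left entry is first moved by `[E_{aa'}, X]` or `[E_{ab'} + E_{ba'}, X]`; and
a member with no usable entry is `c·1` with `tr = 2lc = 0`, so zero (§4).  One `n_{cd}` generates (§5): rows A1-168's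
`[m(E_{xc}), n_{cd}] = n_{xd}` gives all `n_{ab}`, then `[E_{a'a}, n_{ab}] = E_{ba} + E_{a'b'}`,
`[E_{b'b}, E_{ba} + E_{a'b'}] = -p_{ab}`, `[E_{a'b} + E_{b'a}, n_{ab}] = -(d_a - d_b)`, and these span the traceless
`J`-self-adjoint matrices (`mem_of_forall_units_mem`).  §7 transports the core through a Darboux basis.

## Contents (all proved)

* §1 `isSelfAdjoint_J_iff`, `isSelfAdjoint_neg_J_iff`, **`fromBlocks_isSelfAdjoint_J_iff`** (`D = Aᵀ`, `Bᵀ = -B`,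
  `Cᵀ = -C`), entries `apply_inr_inr` / `apply_inl_inr` / `apply_inr_inl` / `apply_inl_inr_self` / `apply_inr_inl_self`,
  `trace_eq_two_mul_sum`;
* §2 the units `nsub_isSelfAdjoint` (`n_{ab}`), `psub_isSelfAdjoint` (`p_{ab}`), `single_inl_inl_add_single_inr_inr_isSelfAdjoint`;
* §3 the bracket table `single_inr_inl_comm_nsub`, `single_inr_inl_comm_qsub`, `single_inl_inr_comm_psub`,
  `single_inl_inr_comm_qsub`, `padd_comm_nsub` (zero weight), the squares `nadd_mul_self` / `padd_mul_self` and sandwiches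
  `nadd_mul_mul_nadd` / `padd_mul_mul_padd` (any `X`), **`nadd_mul_mul_nadd_of_isSelfAdjoint`** (`= X_{b'a} n_{ab}`),
  `padd_mul_mul_padd_of_isSelfAdjoint` (`= -X_{ab'} p_{ab}`);
* §4 `nsub_mem_of_apply_inr_inl_ne_zero`, `nsub_mem_of_apply_inl_inr_ne_zero`, `exists_nsub_mem_of_upperLeft`,
  **`exists_nsub_mem_of_ne_zero`**;
* §5 **`mem_of_forall_units_mem`** (spanning), **`mem_of_nsub_mem`** (generation),
  **`eq_bot_or_forall_mem_of_forall_comm_mem`** (the core: `2 ≠ 0`, `|l| ≠ 0` in `K`);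
* §6 `mem_selfAdjoint_inf_ker_trace_iff`, **`eq_bot_or_eq_of_forall_comm_mem`** (`P = ⊥ ∨ P = sym_J ⊓ ker tr`),
  `…_of_charZero`, `nsub_mem_selfAdjoint_inf_ker_trace` (`𝔤_+ ≠ 0` for `|l| ≥ 2`);
* §7 (basis-free) **`eq_bot_or_eq_of_forall_lie_mem`** (`B` non-degenerate alternating on `U`, `2 ≠ 0`, `dim U ≠ 0` in `K`:
  every `ad(𝔰𝔭(U,B))`-stable `K`-subspace of `B.selfAdjointSubmodule ⊓ ker (LinearMap.trace K U)` is `⊥` or everything),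
  `eq_bot_or_eq_of_forall_lie_mem_of_charZero`.

## Scope

The symplectic summand `𝔤_+(U)` of (7.5) completely (every symplectic `U` over any field with `char K ∤ dim U`,
`char K ≠ 2`); together with row A1-166 (`𝔤_-(U) = 𝔰𝔭(U)` irreducible) this is the whole `ε = -1` case of "the summands
are irreducible".  Not here: the identification `𝔤_+(U) ≅ Λ²₀U` as abstract modules (only the coordinate description),
odd-dimensional orthogonal `𝔤_+` (type `B_ℓ`).  Nothing here is a case of the Hodge conjecture.

## References

* [LooijengaLunts1997] E. Looijenga, V. A. Lunts, *A Lie algebra attached to a projective variety*, Invent. Math. 129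
  (1997) 361–412, Appendix Lemma (7.5), p. 28.
* [Humphreys1972] J. E. Humphreys, *Introduction to Lie Algebras and Representation Theory*, GTM 9, Springer 1972,
  §1.2 p. 3 (type C_ℓ), §2 Exercise 6, §19.2, §20.1–§20.2.
-/

namespace Literature.Algebra.Lie.SymplecticSelfAdjoint

open LieAlgebra LieAlgebra.Symplectic Matrix Sum

variable {l : Type*} [Fintype l] [DecidableEq l] {R : Type*} [CommRing R] {K : Type*} [Field K]

/-! ### Matrix units (file-private plumbing) -/

/-- Matrix units: `E_{pq}E_{rs} = 0` for `q ≠ r`. [folklore] -/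
private theorem E_mul_E_of_ne {ι : Type*} [Fintype ι] [DecidableEq ι] {p q r s : ι} (h : q ≠ r) :
    single p q (1 : R) * single r s (1 : R) = 0 :=
  single_mul_single_of_ne _ _ _ _ h _

/-- Matrix units: `E_{pq}E_{qs} = E_{ps}`. [folklore] -/
private theorem E_mul_E {ι : Type*} [Fintype ι] [DecidableEq ι] (p q s : ι) :
    single p q (1 : R) * single q s (1 : R) = single p s 1 := by
  rw [single_mul_single_same, mul_one]

/-- Matrix units: `E_{pq}XE_{rs} = X_{qr}E_{ps}`. [folklore] -/
private theorem E_mul_mul_E {ι : Type*} [Fintype ι] [DecidableEq ι] (p q r s : ι) (X : Matrix ι ι R) :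
    single p q (1 : R) * X * single r s (1 : R) = single p s (X q r) := by
  rw [single_mul_mul_single, one_mul, mul_one]

/-- Matrix units of size `2l`: `E_{p a'}E_{b s} = 0`. [folklore] -/
private theorem E_inr_mul_E_inl (p s : l ⊕ l) (a b : l) :
    single p (inr a) (1 : R) * single (inl b) s (1 : R) = 0 :=
  E_mul_E_of_ne inr_ne_inl

/-- Matrix units of size `2l`: `E_{p a}E_{b' s} = 0`. [folklore] -/
private theorem E_inl_mul_E_inr (p s : l ⊕ l) (a b : l) :
    single p (inl a) (1 : R) * single (inr b) s (1 : R) = 0 :=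
  E_mul_E_of_ne inl_ne_inr

/-- `cE_{pq} = c • E_{pq}`. [folklore] -/
private theorem single_eq_smul_E {ι : Type*} [DecidableEq ι] (p q : ι) (c : R) :
    single p q c = c • single p q (1 : R) := by
  rw [smul_single, smul_eq_mul, mul_one]

/-! ### §1 Self-adjoint matrices for `J = (0 -I; I 0)`: block form `(A B; C Aᵀ)` with `B`, `C` ANTISYMMETRIC -/

/-- `X` is self-adjoint for `J` iff `XᵀJ = JX` (Mathlib's `Matrix.IsSelfAdjoint`, definitional).
[cite: LooijengaLunts1997, Appendix (7.5), p. 28 L80–L84 ("⟨xu, u'⟩ = +⟨u, xu'⟩")] -/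
theorem isSelfAdjoint_J_iff (X : Matrix (l ⊕ l) (l ⊕ l) R) :
    (Matrix.J l R).IsSelfAdjoint X ↔ Xᵀ * Matrix.J l R = Matrix.J l R * X :=
  Iff.rfl

/-- Self-adjointness for `-J` (the Gram matrix of a Darboux basis) is self-adjointness for `J` (`Xᵀ(-J) = (-J)X ↔ XᵀJ = JX`).
[cite: Humphreys1972, §1.2, p. 3 (type C_ℓ: the condition `sx = xᵗs` is insensitive to the sign of `s`)] -/
theorem isSelfAdjoint_neg_J_iff (X : Matrix (l ⊕ l) (l ⊕ l) R) :
    (-Matrix.J l R).IsSelfAdjoint X ↔ (Matrix.J l R).IsSelfAdjoint X := by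
  rw [isSelfAdjoint_J_iff, Matrix.IsSelfAdjoint, Matrix.IsAdjointPair, Matrix.mul_neg, Matrix.neg_mul, neg_inj]

/-- **Block form of the `J`-self-adjoint matrices**: `(A B; C D)` is `J`-self-adjoint iff `D = Aᵀ`, `Bᵀ = -B`, `Cᵀ = -C`
(`𝔤_+(U) ≅ Λ²U` for a symplectic `U`; compare `𝔰𝔭`: `D = -Aᵀ`, `B`, `C` symmetric). [cite: Humphreys1972, §1.2, p. 3 (type C_ℓ)] [cite: LooijengaLunts1997, Appendix (7.5), p. 28] -/
theorem fromBlocks_isSelfAdjoint_J_iff (A B C D : Matrix l l R) :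
    (Matrix.J l R).IsSelfAdjoint (fromBlocks A B C D) ↔ D = Aᵀ ∧ Bᵀ = -B ∧ Cᵀ = -C := by
  rw [isSelfAdjoint_J_iff, Matrix.J, fromBlocks_transpose, fromBlocks_multiply, fromBlocks_multiply, fromBlocks_inj]
  simp only [Matrix.mul_zero, Matrix.mul_one, Matrix.mul_neg, zero_add, add_zero, Matrix.zero_mul, Matrix.one_mul,
    Matrix.neg_mul]
  constructor
  · rintro ⟨hC, hA, -, hB⟩
    exact ⟨(neg_inj.1 hA).symm, neg_eq_iff_eq_neg.1 hB, hC⟩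
  · rintro ⟨hD, hB, hC⟩
    exact ⟨hC, by rw [hD], by rw [hD, transpose_transpose], by rw [hB, neg_neg]⟩

/-- Lower-right block: `X_{a'b'} = X_{ba}`. [cite: Humphreys1972, §1.2, p. 3] -/
theorem apply_inr_inr {X : Matrix (l ⊕ l) (l ⊕ l) R} (hX : (Matrix.J l R).IsSelfAdjoint X) (a b : l) :
    X (inr a) (inr b) = X (inl b) (inl a) := by
  rw [← fromBlocks_toBlocks X, fromBlocks_isSelfAdjoint_J_iff] at hX
  simpa [toBlocks₂₂, toBlocks₁₁] using congrFun (congrFun hX.1 a) b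

/-- Upper-right block antisymmetric: `X_{ab'} = -X_{ba'}`. [cite: Humphreys1972, §1.2, p. 3] -/
theorem apply_inl_inr {X : Matrix (l ⊕ l) (l ⊕ l) R} (hX : (Matrix.J l R).IsSelfAdjoint X) (a b : l) :
    X (inl a) (inr b) = -X (inl b) (inr a) := by
  rw [← fromBlocks_toBlocks X, fromBlocks_isSelfAdjoint_J_iff] at hX
  have h : X (inl b) (inr a) = -X (inl a) (inr b) := by
    simpa [toBlocks₁₂] using congrFun (congrFun hX.2.1 a) b
  rw [h, neg_neg]

/-- Lower-left block antisymmetric: `X_{a'b} = -X_{b'a}`. [cite: Humphreys1972, §1.2, p. 3] -/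
theorem apply_inr_inl {X : Matrix (l ⊕ l) (l ⊕ l) R} (hX : (Matrix.J l R).IsSelfAdjoint X) (a b : l) :
    X (inr a) (inl b) = -X (inr b) (inl a) := by
  rw [← fromBlocks_toBlocks X, fromBlocks_isSelfAdjoint_J_iff] at hX
  have h : X (inr b) (inl a) = -X (inr a) (inl b) := by
    simpa [toBlocks₂₁] using congrFun (congrFun hX.2.2 a) b
  rw [h, neg_neg]

/-- `X_{aa'} = 0` when `2 ≠ 0`. [cite: Humphreys1972, §1.2, p. 3] -/
theorem apply_inl_inr_self (h2 : (2 : K) ≠ 0) {X : Matrix (l ⊕ l) (l ⊕ l) K} (hX : (Matrix.J l K).IsSelfAdjoint X)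
    (a : l) : X (inl a) (inr a) = 0 := by
  have h := apply_inl_inr hX a a
  have h2a : (2 : K) * X (inl a) (inr a) = 0 := by
    rw [two_mul]; nth_rw 1 [h]; rw [neg_add_cancel]
  exact (mul_eq_zero.1 h2a).resolve_left h2

/-- `X_{a'a} = 0` when `2 ≠ 0`. [cite: Humphreys1972, §1.2, p. 3] -/
theorem apply_inr_inl_self (h2 : (2 : K) ≠ 0) {X : Matrix (l ⊕ l) (l ⊕ l) K} (hX : (Matrix.J l K).IsSelfAdjoint X)
    (a : l) : X (inr a) (inl a) = 0 := by
  have h := apply_inr_inl hX a a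
  have h2a : (2 : K) * X (inr a) (inl a) = 0 := by
    rw [two_mul]; nth_rw 1 [h]; rw [neg_add_cancel]
  exact (mul_eq_zero.1 h2a).resolve_left h2

/-- `tr X = 2 Σ_a X_{aa}` for `J`-self-adjoint `X = (A B; C Aᵀ)`. [cite: LooijengaLunts1997, Appendix (7.5), p. 28] -/
theorem trace_eq_two_mul_sum {X : Matrix (l ⊕ l) (l ⊕ l) R} (hX : (Matrix.J l R).IsSelfAdjoint X) :
    Matrix.trace X = 2 * ∑ a, X (inl a) (inl a) := by
  rw [Matrix.trace, Fintype.sum_sum_type, two_mul]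
  simp only [diag_apply, apply_inr_inr hX]

/-! ### §2 `J`-self-adjoint matrix units: `n_{ab} = E_{ab'} - E_{ba'}`, `p_{ab} = E_{a'b} - E_{b'a}`, `E_{ab} + E_{b'a'}`

(`n_{ab}`, `p_{ab}` are Humphreys' root vectors of `𝔬(2l)` = rows A1-168/169's units — here they are the weight vectors of
`Λ²`.) -/

/-- `n_{ab} = E_{ab'} - E_{ba'}` is `J`-self-adjoint. [cite: Humphreys1972, §1.2] [cite: LooijengaLunts1997, Appendix (7.5)] -/
theorem nsub_isSelfAdjoint (a b : l) :
    (Matrix.J l R).IsSelfAdjoint (single (inl a) (inr b) (1 : R) - single (inl b) (inr a) 1) := by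
  rw [SymplecticSimple.single_inl_inr, SymplecticSimple.single_inl_inr, sub_eq_add_neg, fromBlocks_neg, fromBlocks_add,
    fromBlocks_isSelfAdjoint_J_iff]
  refine ⟨by simp, ?_, by simp⟩
  rw [transpose_add, transpose_neg, transpose_single, transpose_single]
  abel

/-- `p_{ab} = E_{a'b} - E_{b'a}` is `J`-self-adjoint. [cite: Humphreys1972, §1.2] [cite: LooijengaLunts1997, Appendix (7.5)] -/
theorem psub_isSelfAdjoint (a b : l) :
    (Matrix.J l R).IsSelfAdjoint (single (inr a) (inl b) (1 : R) - single (inr b) (inl a) 1) := by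
  rw [SymplecticSimple.single_inr_inl, SymplecticSimple.single_inr_inl, sub_eq_add_neg, fromBlocks_neg, fromBlocks_add,
    fromBlocks_isSelfAdjoint_J_iff]
  refine ⟨by simp, by simp, ?_⟩
  rw [transpose_add, transpose_neg, transpose_single, transpose_single]
  abel

/-- `E_{ab} + E_{b'a'}` (for `a = b`: `d_a = E_{aa} + E_{a'a'}`) is `J`-self-adjoint. [cite: Humphreys1972, §1.2] [cite: LooijengaLunts1997, Appendix (7.5)] -/
theorem single_inl_inl_add_single_inr_inr_isSelfAdjoint (a b : l) :
    (Matrix.J l R).IsSelfAdjoint (single (inl a) (inl b) (1 : R) + single (inr b) (inr a) 1) := by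
  rw [SymplecticSimple.single_inl_inl, SymplecticSimple.single_inr_inr, fromBlocks_add, fromBlocks_isSelfAdjoint_J_iff]
  refine ⟨?_, by simp, by simp⟩
  rw [zero_add, add_zero, transpose_single]

/-! ### §3 Bracket table: Humphreys' basis of `𝔰𝔭(2l)` (`m(E_{vu})`, `E_{aa'}`, `E_{a'a}`, `E_{ab'} + E_{ba'}`,
`E_{a'b} + E_{b'a}`) acting on the units of §2 [Humphreys1972, §1.2 (type C_ℓ), §20.1] -/

/-- `[E_{a'a}, n_{ab}] = E_{ba} + E_{a'b'}` for `a ≠ b`. [cite: Humphreys1972, §1.2, §20.1] -/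
theorem single_inr_inl_comm_nsub {a b : l} (hab : a ≠ b) :
    single (inr a) (inl a) (1 : R) * (single (inl a) (inr b) (1 : R) - single (inl b) (inr a) 1)
      - (single (inl a) (inr b) (1 : R) - single (inl b) (inr a) 1) * single (inr a) (inl a) (1 : R)
      = single (inl b) (inl a) 1 + single (inr a) (inr b) 1 := by
  have h1 : (inl a : l ⊕ l) ≠ inl b := fun h => hab (inl_injective h)
  have h2 : (inr b : l ⊕ l) ≠ inr a := fun h => hab (inr_injective h).symm
  simp only [Matrix.mul_sub, Matrix.sub_mul, E_mul_E, E_mul_E_of_ne h1, E_mul_E_of_ne h2]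
  abel

/-- `[E_{b'b}, E_{ba} + E_{a'b'}] = -p_{ab} = -(E_{a'b} - E_{b'a})`. [cite: Humphreys1972, §1.2, §20.1] -/
theorem single_inr_inl_comm_qsub (a b : l) :
    single (inr b) (inl b) (1 : R) * (single (inl b) (inl a) (1 : R) + single (inr a) (inr b) 1)
      - (single (inl b) (inl a) (1 : R) + single (inr a) (inr b) 1) * single (inr b) (inl b) (1 : R)
      = -(single (inr a) (inl b) 1 - single (inr b) (inl a) 1) := by
  simp only [Matrix.mul_add, Matrix.add_mul, E_mul_E, E_inl_mul_E_inr]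
  abel

/-- `[E_{aa'}, p_{ab}] = E_{ab} + E_{b'a'}` for `a ≠ b`. [cite: Humphreys1972, §1.2, §20.1] -/
theorem single_inl_inr_comm_psub {a b : l} (hab : a ≠ b) :
    single (inl a) (inr a) (1 : R) * (single (inr a) (inl b) (1 : R) - single (inr b) (inl a) 1)
      - (single (inr a) (inl b) (1 : R) - single (inr b) (inl a) 1) * single (inl a) (inr a) (1 : R)
      = single (inl a) (inl b) 1 + single (inr b) (inr a) 1 := by
  have h1 : (inr a : l ⊕ l) ≠ inr b := fun h => hab (inr_injective h)
  have h2 : (inl b : l ⊕ l) ≠ inl a := fun h => hab (inl_injective h).symm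
  simp only [Matrix.mul_sub, Matrix.sub_mul, E_mul_E, E_mul_E_of_ne h1, E_mul_E_of_ne h2]
  abel

/-- `[E_{bb'}, E_{ab} + E_{b'a'}] = -n_{ab} = -(E_{ab'} - E_{ba'})`. [cite: Humphreys1972, §1.2, §20.1] -/
theorem single_inl_inr_comm_qsub (a b : l) :
    single (inl b) (inr b) (1 : R) * (single (inl a) (inl b) (1 : R) + single (inr b) (inr a) 1)
      - (single (inl a) (inl b) (1 : R) + single (inr b) (inr a) 1) * single (inl b) (inr b) (1 : R)
      = -(single (inl a) (inr b) 1 - single (inl b) (inr a) 1) := by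
  simp only [Matrix.mul_add, Matrix.add_mul, E_mul_E, E_inr_mul_E_inl]
  abel

/-- `[E_{a'b} + E_{b'a}, n_{ab}] = -(d_a - d_b)`, `d_a = E_{aa} + E_{a'a'}`, for `a ≠ b` (a zero-weight vector).
[cite: Humphreys1972, §1.2, §20.1] -/
theorem padd_comm_nsub {a b : l} (hab : a ≠ b) :
    (single (inr a) (inl b) (1 : R) + single (inr b) (inl a) 1) * (single (inl a) (inr b) (1 : R) - single (inl b) (inr a) 1)
      - (single (inl a) (inr b) (1 : R) - single (inl b) (inr a) 1) * (single (inr a) (inl b) (1 : R) + single (inr b) (inl a) 1)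
      = -((single (inl a) (inl a) 1 + single (inr a) (inr a) 1) - (single (inl b) (inl b) 1 + single (inr b) (inr b) 1)) := by
  have h1 : (inl b : l ⊕ l) ≠ inl a := fun h => hab (inl_injective h).symm
  have h1' : (inl a : l ⊕ l) ≠ inl b := fun h => hab (inl_injective h)
  have h2 : (inr b : l ⊕ l) ≠ inr a := fun h => hab (inr_injective h).symm
  have h2' : (inr a : l ⊕ l) ≠ inr b := fun h => hab (inr_injective h)
  simp only [Matrix.add_mul, Matrix.mul_sub, Matrix.sub_mul, Matrix.mul_add, E_mul_E, E_mul_E_of_ne h1,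
    E_mul_E_of_ne h1', E_mul_E_of_ne h2, E_mul_E_of_ne h2']
  abel

/-- `(E_{ab'} + E_{ba'})² = 0`. [cite: Humphreys1972, §1.2 (type C_ℓ)] -/
theorem nadd_mul_self (a b : l) :
    (single (inl a) (inr b) (1 : R) + single (inl b) (inr a) 1) * (single (inl a) (inr b) (1 : R) + single (inl b) (inr a) 1)
      = (0 : Matrix (l ⊕ l) (l ⊕ l) R) := by
  simp only [Matrix.add_mul, Matrix.mul_add, E_inr_mul_E_inl, add_zero]

/-- `(E_{a'b} + E_{b'a})² = 0`. [cite: Humphreys1972, §1.2 (type C_ℓ)] -/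
theorem padd_mul_self (a b : l) :
    (single (inr a) (inl b) (1 : R) + single (inr b) (inl a) 1) * (single (inr a) (inl b) (1 : R) + single (inr b) (inl a) 1)
      = (0 : Matrix (l ⊕ l) (l ⊕ l) R) := by
  simp only [Matrix.add_mul, Matrix.mul_add, E_inl_mul_E_inr, add_zero]

/-- `(E_{ab'} + E_{ba'}) X (E_{ab'} + E_{ba'}) = X_{b'a}E_{ab'} + X_{b'b}E_{aa'} + X_{a'a}E_{bb'} + X_{a'b}E_{ba'}` for every `X`.
[cite: Humphreys1972, §2 Exercise 6] -/
theorem nadd_mul_mul_nadd (a b : l) (X : Matrix (l ⊕ l) (l ⊕ l) R) :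
    (single (inl a) (inr b) (1 : R) + single (inl b) (inr a) 1) * X * (single (inl a) (inr b) (1 : R) + single (inl b) (inr a) 1)
      = single (inl a) (inr b) (X (inr b) (inl a)) + single (inl a) (inr a) (X (inr b) (inl b))
        + single (inl b) (inr b) (X (inr a) (inl a)) + single (inl b) (inr a) (X (inr a) (inl b)) := by
  simp only [Matrix.add_mul, Matrix.mul_add, E_mul_mul_E]
  abel

/-- `(E_{a'b} + E_{b'a}) X (E_{a'b} + E_{b'a}) = X_{ba'}E_{a'b} + X_{bb'}E_{a'a} + X_{aa'}E_{b'b} + X_{ab'}E_{b'a}` for every `X`.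
[cite: Humphreys1972, §2 Exercise 6] -/
theorem padd_mul_mul_padd (a b : l) (X : Matrix (l ⊕ l) (l ⊕ l) R) :
    (single (inr a) (inl b) (1 : R) + single (inr b) (inl a) 1) * X * (single (inr a) (inl b) (1 : R) + single (inr b) (inl a) 1)
      = single (inr a) (inl b) (X (inl b) (inr a)) + single (inr a) (inl a) (X (inl b) (inr b))
        + single (inr b) (inl b) (X (inl a) (inr a)) + single (inr b) (inl a) (X (inl a) (inr b)) := by
  simp only [Matrix.add_mul, Matrix.mul_add, E_mul_mul_E]
  abel

/-- For `J`-self-adjoint `X` (`2 ≠ 0`): `(E_{ab'} + E_{ba'}) X (E_{ab'} + E_{ba'}) = X_{b'a} · n_{ab}` — ONE weight vector.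
[cite: Humphreys1972, §2 Exercise 6, §20.1] -/
theorem nadd_mul_mul_nadd_of_isSelfAdjoint (h2 : (2 : K) ≠ 0) {X : Matrix (l ⊕ l) (l ⊕ l) K}
    (hX : (Matrix.J l K).IsSelfAdjoint X) (a b : l) :
    (single (inl a) (inr b) (1 : K) + single (inl b) (inr a) 1) * X * (single (inl a) (inr b) (1 : K) + single (inl b) (inr a) 1)
      = X (inr b) (inl a) • (single (inl a) (inr b) (1 : K) - single (inl b) (inr a) 1) := by
  rw [nadd_mul_mul_nadd, apply_inr_inl_self h2 hX, apply_inr_inl_self h2 hX, apply_inr_inl hX a b,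
    single_eq_smul_E (inl a) (inr b) (X (inr b) (inl a)), single_eq_smul_E (inl b) (inr a) (-X (inr b) (inl a)), smul_sub,
    single_zero, single_zero, neg_smul]
  abel

/-- For `J`-self-adjoint `X` (`2 ≠ 0`): `(E_{a'b} + E_{b'a}) X (E_{a'b} + E_{b'a}) = -X_{ab'} · p_{ab}`. [cite: Humphreys1972, §2 Exercise 6, §20.1] -/
theorem padd_mul_mul_padd_of_isSelfAdjoint (h2 : (2 : K) ≠ 0) {X : Matrix (l ⊕ l) (l ⊕ l) K}
    (hX : (Matrix.J l K).IsSelfAdjoint X) (a b : l) :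
    (single (inr a) (inl b) (1 : K) + single (inr b) (inl a) 1) * X * (single (inr a) (inl b) (1 : K) + single (inr b) (inl a) 1)
      = -(X (inl a) (inr b) • (single (inr a) (inl b) (1 : K) - single (inr b) (inl a) 1)) := by
  rw [padd_mul_mul_padd, apply_inl_inr_self h2 hX, apply_inl_inr_self h2 hX, apply_inl_inr hX b a,
    single_eq_smul_E (inr a) (inl b) (-X (inl a) (inr b)), single_eq_smul_E (inr b) (inl a) (X (inl a) (inr b)), smul_sub,
    single_zero, single_zero, neg_smul]
  abel

/-! ### §4 Extraction: a non-zero `J`-self-adjoint member of an `ad 𝔰𝔭(2l)`-stable `P` yields a unit `n_{cd} ∈ P`, `c ≠ d` -/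

section stable

variable {P : Submodule K (Matrix (l ⊕ l) (l ⊕ l) K)}

/-- Lower-left entry `X_{b'a} ≠ 0` of `X ∈ P`: `n_{ab} ∈ P` and `a ≠ b` (via `(ad (E_{ab'} + E_{ba'}))²X = -2X_{b'a} n_{ab}`).
[cite: Humphreys1972, §2 Exercise 6, §19.2] -/
theorem nsub_mem_of_apply_inr_inl_ne_zero (h2 : (2 : K) ≠ 0)
    (hP : ∀ ⦃Y m : Matrix (l ⊕ l) (l ⊕ l) K⦄, Y ∈ sp l K → m ∈ P → Y * m - m * Y ∈ P)
    {X : Matrix (l ⊕ l) (l ⊕ l) K} (hX : (Matrix.J l K).IsSelfAdjoint X) (hXP : X ∈ P) {a b : l}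
    (hne : X (inr b) (inl a) ≠ 0) :
    a ≠ b ∧ single (inl a) (inr b) (1 : K) - single (inl b) (inr a) 1 ∈ P := by
  have hab : a ≠ b := by
    rintro rfl
    exact hne (apply_inr_inl_self h2 hX a)
  refine ⟨hab, ?_⟩
  have hn := SymplecticSimple.single_inl_inr_add_mem_sp (R := K) a b
  have h1 := hP hn (hP hn hXP)
  rw [OrthogonalSimpleTypeD.comm_comm_eq_of_mul_self_eq_zero (nadd_mul_self a b),
    nadd_mul_mul_nadd_of_isSelfAdjoint h2 hX, smul_smul, ← neg_smul] at h1
  exact (P.smul_mem_iff (neg_ne_zero.2 (mul_ne_zero h2 hne))).1 h1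

/-- Upper-right entry `X_{ab'} ≠ 0` of `X ∈ P`: `p_{ab} ∈ P`, then `E_{ab} + E_{b'a'} = [E_{aa'}, p_{ab}] ∈ P` and
`n_{ab} = -[E_{bb'}, E_{ab} + E_{b'a'}] ∈ P`. [cite: Humphreys1972, §2 Exercise 6, §19.2, §20.1] -/
theorem nsub_mem_of_apply_inl_inr_ne_zero (h2 : (2 : K) ≠ 0)
    (hP : ∀ ⦃Y m : Matrix (l ⊕ l) (l ⊕ l) K⦄, Y ∈ sp l K → m ∈ P → Y * m - m * Y ∈ P)
    {X : Matrix (l ⊕ l) (l ⊕ l) K} (hX : (Matrix.J l K).IsSelfAdjoint X) (hXP : X ∈ P) {a b : l}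
    (hne : X (inl a) (inr b) ≠ 0) :
    a ≠ b ∧ single (inl a) (inr b) (1 : K) - single (inl b) (inr a) 1 ∈ P := by
  have hab : a ≠ b := by
    rintro rfl
    exact hne (apply_inl_inr_self h2 hX a)
  refine ⟨hab, ?_⟩
  have hp := SymplecticSimple.single_inr_inl_add_mem_sp (R := K) a b
  have h1 := hP hp (hP hp hXP)
  rw [OrthogonalSimpleTypeD.comm_comm_eq_of_mul_self_eq_zero (padd_mul_self a b),
    padd_mul_mul_padd_of_isSelfAdjoint h2 hX, smul_neg, neg_neg, smul_smul] at h1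
  have hpP : single (inr a) (inl b) (1 : K) - single (inr b) (inl a) 1 ∈ P :=
    (P.smul_mem_iff (mul_ne_zero h2 hne)).1 h1
  have hq := hP (SymplecticSimple.single_inl_inr_mem_sp (R := K) a) hpP
  rw [single_inl_inr_comm_psub hab] at hq
  have hn := hP (SymplecticSimple.single_inl_inr_mem_sp (R := K) b) hq
  rw [single_inl_inr_comm_qsub, P.neg_mem_iff] at hn
  exact hn

/-- Upper-left block: if `X_{ba} ≠ 0` for some `a ≠ b`, or `X_{aa} ≠ X_{bb}`, then some `n_{cd} ∈ P` (`c ≠ d`):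
`[E_{aa'}, X]` has `(a, b')` entry `X_{ba}`, `[E_{ab'} + E_{ba'}, X]` has `(a, b')` entry `X_{bb} - X_{aa}`.
[cite: Humphreys1972, §2 Exercise 6, §19.2] -/
theorem exists_nsub_mem_of_upperLeft (h2 : (2 : K) ≠ 0)
    (hP : ∀ ⦃Y m : Matrix (l ⊕ l) (l ⊕ l) K⦄, Y ∈ sp l K → m ∈ P → Y * m - m * Y ∈ P)
    (hPS : ∀ ⦃m : Matrix (l ⊕ l) (l ⊕ l) K⦄, m ∈ P → (Matrix.J l K).IsSelfAdjoint m)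
    {X : Matrix (l ⊕ l) (l ⊕ l) K} (hXP : X ∈ P) {a b : l} (hab : a ≠ b)
    (hne : X (inl b) (inl a) ≠ 0 ∨ X (inl a) (inl a) ≠ X (inl b) (inl b)) :
    ∃ c d : l, c ≠ d ∧ single (inl c) (inr d) (1 : K) - single (inl d) (inr c) 1 ∈ P := by
  have hX := hPS hXP
  have hba : (inr b : l ⊕ l) ≠ inr a := fun h => hab (inr_injective h).symm
  have hab' : (inl a : l ⊕ l) ≠ inl b := fun h => hab (inl_injective h)
  rcases hne with hne | hne
  · -- `W = [E_{aa'}, X]`, `W_{ab'} = X_{a'b'} = X_{ba}`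
    have hW := hP (SymplecticSimple.single_inl_inr_mem_sp (R := K) a) hXP
    refine ⟨a, b, (nsub_mem_of_apply_inl_inr_ne_zero h2 hP (hPS hW) hW (a := a) (b := b) ?_)⟩
    rw [Matrix.sub_apply, single_mul_apply_same, mul_single_apply_of_ne (hbj := hba), one_mul, sub_zero,
      apply_inr_inr hX]
    exact hne
  · -- `W = [E_{ab'} + E_{ba'}, X]`, `W_{ab'} = X_{b'b'} - X_{aa} = X_{bb} - X_{aa}`
    have hW := hP (SymplecticSimple.single_inl_inr_add_mem_sp (R := K) a b) hXP
    refine ⟨a, b, (nsub_mem_of_apply_inl_inr_ne_zero h2 hP (hPS hW) hW (a := a) (b := b) ?_)⟩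
    rw [Matrix.sub_apply, Matrix.add_mul, Matrix.mul_add, Matrix.add_apply, Matrix.add_apply, single_mul_apply_same,
      single_mul_apply_of_ne (h := hab'), mul_single_apply_same, mul_single_apply_of_ne (hbj := hba), one_mul, mul_one,
      add_zero, add_zero, apply_inr_inr hX, sub_ne_zero]
    exact hne.symm

/-- **Step 1**: a non-zero `X ∈ P` (`P` an `ad 𝔰𝔭(2l)`-stable subspace of traceless `J`-self-adjoint matrices, `2 ≠ 0`,
`|l| ≠ 0` in `K`) yields a unit `n_{cd} ∈ P` with `c ≠ d`.  With no usable entry `X = c·1` and `tr X = 2|l|c = 0`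
forces `X = 0` — for `char K ∣ |l|` the identity IS a traceless self-adjoint invariant line (`Λ²U ⊋ Λ²₀U ⊕ K·ω` then).
[cite: Humphreys1972, §2 Exercise 6, §19.2] [cite: LooijengaLunts1997, Appendix (7.5), p. 28 L89] -/
theorem exists_nsub_mem_of_ne_zero (h2 : (2 : K) ≠ 0) (hl : ((Fintype.card l : ℕ) : K) ≠ 0)
    (hP : ∀ ⦃Y m : Matrix (l ⊕ l) (l ⊕ l) K⦄, Y ∈ sp l K → m ∈ P → Y * m - m * Y ∈ P)
    (hPS : ∀ ⦃m : Matrix (l ⊕ l) (l ⊕ l) K⦄, m ∈ P → (Matrix.J l K).IsSelfAdjoint m)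
    (hPT : ∀ ⦃m : Matrix (l ⊕ l) (l ⊕ l) K⦄, m ∈ P → Matrix.trace m = 0)
    {X : Matrix (l ⊕ l) (l ⊕ l) K} (hXP : X ∈ P) (hX0 : X ≠ 0) :
    ∃ c d : l, c ≠ d ∧ single (inl c) (inr d) (1 : K) - single (inl d) (inr c) 1 ∈ P := by
  have hX := hPS hXP
  by_cases hC : ∃ a b : l, X (inr b) (inl a) ≠ 0
  · obtain ⟨a, b, hne⟩ := hC
    exact ⟨a, b, nsub_mem_of_apply_inr_inl_ne_zero h2 hP hX hXP hne⟩
  by_cases hB : ∃ a b : l, X (inl a) (inr b) ≠ 0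
  · obtain ⟨a, b, hne⟩ := hB
    exact ⟨a, b, nsub_mem_of_apply_inl_inr_ne_zero h2 hP hX hXP hne⟩
  by_cases hA : ∃ a b : l, a ≠ b ∧ (X (inl b) (inl a) ≠ 0 ∨ X (inl a) (inl a) ≠ X (inl b) (inl b))
  · obtain ⟨a, b, hab, hne⟩ := hA
    exact exists_nsub_mem_of_upperLeft h2 hP hPS hXP hab hne
  push Not at hC hB hA
  exfalso
  apply hX0
  -- `X = c·1` with `2|l|c = tr X = 0`
  have hne : Nonempty l := by
    by_contra h
    rw [not_nonempty_iff] at h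
    exact hl (by rw [Fintype.card_eq_zero, Nat.cast_zero])
  obtain ⟨a₀⟩ := hne
  have hdiag : ∀ a : l, X (inl a) (inl a) = X (inl a₀) (inl a₀) := by
    intro a
    by_cases ha : a = a₀
    · rw [ha]
    · exact (hA a a₀ ha).2
  have hc : X (inl a₀) (inl a₀) = 0 := by
    have htr := hPT hXP
    rw [trace_eq_two_mul_sum hX] at htr
    simp only [hdiag, Finset.sum_const, Finset.card_univ, nsmul_eq_mul] at htr
    rcases mul_eq_zero.1 htr with h | h
    · exact absurd h h2
    · exact (mul_eq_zero.1 h).resolve_left hl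
  ext p q
  rw [Matrix.zero_apply]
  rcases p with a | a <;> rcases q with b | b
  · by_cases hba : b = a
    · subst hba; rw [hdiag, hc]
    · exact (hA b a hba).1
  · exact hB a b
  · exact hC b a
  · rw [apply_inr_inr hX]
    by_cases hab : a = b
    · subst hab; rw [hdiag, hc]
    · exact (hA a b hab).1

/-! ### §5 Generation from one `n_{cd}` and spanning of the traceless `J`-self-adjoint matrices -/

/-- **Spanning**: ANY `K`-subspace `P` (`2 ≠ 0`) containing `E_{ab} + E_{b'a'}` (`a ≠ b`), the differences
`d_a - d_b`, all `n_{ab}` and all `p_{ab}` contains every TRACELESS `J`-self-adjoint `X = (A B; C Aᵀ)`: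
`(A 0; 0 Aᵀ) = Σ_{a≠b} A_{ab}(E_{ab} + E_{b'a'}) + Σ_a A_{aa}(d_a - d_{a₀})`, `2(0 B; 0 0) = Σ B_{ab} n_{ab}` (`Bᵀ = -B`),
`2(0 0; C 0) = Σ C_{ab} p_{ab}`. [cite: Humphreys1972, §1.2, p. 3] [cite: LooijengaLunts1997, Appendix (7.5), p. 28] -/
theorem mem_of_forall_units_mem (h2 : (2 : K) ≠ 0)
    (hQ : ∀ a b : l, a ≠ b → single (inl a) (inl b) (1 : K) + single (inr b) (inr a) 1 ∈ P)
    (hD : ∀ a b : l, (single (inl a) (inl a) (1 : K) + single (inr a) (inr a) 1)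
      - (single (inl b) (inl b) (1 : K) + single (inr b) (inr b) 1) ∈ P)
    (hN : ∀ a b : l, single (inl a) (inr b) (1 : K) - single (inl b) (inr a) 1 ∈ P)
    (hV : ∀ a b : l, single (inr a) (inl b) (1 : K) - single (inr b) (inl a) 1 ∈ P)
    {X : Matrix (l ⊕ l) (l ⊕ l) K} (hX : (Matrix.J l K).IsSelfAdjoint X) (htr : Matrix.trace X = 0) : X ∈ P := by
  have hPsmul : ∀ {c : K} {m : Matrix (l ⊕ l) (l ⊕ l) K}, c ≠ 0 → c • m ∈ P → m ∈ P :=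
    fun hc hm => (P.smul_mem_iff hc).1 hm
  have htrA : ∑ a, X (inl a) (inl a) = 0 := by
    rw [trace_eq_two_mul_sum hX] at htr
    exact (mul_eq_zero.1 htr).resolve_left h2
  rw [← fromBlocks_toBlocks X] at hX ⊢
  obtain ⟨hDA, hBB, hCC⟩ := (fromBlocks_isSelfAdjoint_J_iff _ _ _ _).1 hX
  rw [hDA]
  have e : fromBlocks X.toBlocks₁₁ X.toBlocks₁₂ X.toBlocks₂₁ X.toBlocks₁₁ᵀ =
      fromBlocks X.toBlocks₁₁ 0 0 X.toBlocks₁₁ᵀ + fromBlocks 0 X.toBlocks₁₂ 0 0 + fromBlocks 0 0 X.toBlocks₂₁ 0 := by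
    rw [fromBlocks_add, fromBlocks_add]
    simp
  rw [e]
  refine add_mem (add_mem ?_ ?_) ?_
  · -- the diagonal blocks (as in `OrthogonalSelfAdjointTypeD.mem_of_forall_units_mem`)
    let L : Matrix l l K →ₗ[K] Matrix (l ⊕ l) (l ⊕ l) K :=
      { toFun := fun x => fromBlocks x 0 0 xᵀ
        map_add' := fun x y => by rw [fromBlocks_add, add_zero, transpose_add]
        map_smul' := fun c x => by rw [RingHom.id_apply, fromBlocks_smul, smul_zero, transpose_smul] }
    have hL : ∀ a b : l, L (single a b (1 : K)) = single (inl a) (inl b) (1 : K) + single (inr b) (inr a) 1 := by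
      intro a b
      change fromBlocks (single a b (1 : K)) 0 0 (single a b (1 : K))ᵀ = _
      rw [transpose_single, SymplecticSimple.single_inl_inl, SymplecticSimple.single_inr_inr, fromBlocks_add]
      simp
    change L X.toBlocks₁₁ ∈ P
    have hA : X.toBlocks₁₁ = ∑ a, ∑ b, X.toBlocks₁₁ a b • single a b (1 : K) := by
      simpa only [smul_single, smul_eq_mul, mul_one] using matrix_eq_sum_single X.toBlocks₁₁
    rw [hA, map_sum]
    simp only [map_sum, map_smul, hL]
    have hsplit : ∀ a : l, ∑ b, X.toBlocks₁₁ a b • (single (inl a) (inl b) (1 : K) + single (inr b) (inr a) 1)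
        = X.toBlocks₁₁ a a • (single (inl a) (inl a) (1 : K) + single (inr a) (inr a) 1)
          + ∑ b ∈ Finset.univ.erase a, X.toBlocks₁₁ a b • (single (inl a) (inl b) (1 : K) + single (inr b) (inr a) 1) :=
      fun a => (Finset.add_sum_erase _ _ (Finset.mem_univ a)).symm
    simp only [hsplit, Finset.sum_add_distrib]
    refine add_mem ?_ (P.sum_mem fun a _ => P.sum_mem fun b hb => P.smul_mem _ (hQ a b (Finset.ne_of_mem_erase hb).symm))
    rcases isEmpty_or_nonempty l with hl | ⟨⟨a₀⟩⟩
    · simp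
    have hdiag : ∀ a, X.toBlocks₁₁ a a = X (inl a) (inl a) := fun a => rfl
    have e2 : ∑ a, X.toBlocks₁₁ a a • (single (inl a) (inl a) (1 : K) + single (inr a) (inr a) 1)
        = ∑ a, X.toBlocks₁₁ a a • ((single (inl a) (inl a) (1 : K) + single (inr a) (inr a) 1)
            - (single (inl a₀) (inl a₀) (1 : K) + single (inr a₀) (inr a₀) 1))
          + (∑ a, X.toBlocks₁₁ a a) • (single (inl a₀) (inl a₀) (1 : K) + single (inr a₀) (inr a₀) 1) := by
      rw [Finset.sum_smul, ← Finset.sum_add_distrib]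
      refine Finset.sum_congr rfl fun a _ => ?_
      rw [smul_sub, sub_add_cancel]
    simp only [hdiag] at e2 ⊢
    rw [e2, htrA, zero_smul, add_zero]
    exact P.sum_mem fun a _ => P.smul_mem _ (hD a a₀)
  · -- the block `B`: `2(0 B; 0 0) = (0 B-Bᵀ; 0 0) = Σ B_{ab} n_{ab}`
    let L : Matrix l l K →ₗ[K] Matrix (l ⊕ l) (l ⊕ l) K :=
      { toFun := fun x => fromBlocks 0 x 0 0
        map_add' := fun x y => by rw [fromBlocks_add, add_zero]
        map_smul' := fun c x => by rw [RingHom.id_apply, fromBlocks_smul, smul_zero] }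
    have hL : ∀ a b : l, L (single a b (1 : K) - single b a 1) ∈ P := by
      intro a b
      change fromBlocks 0 (single a b (1 : K) - single b a 1) 0 0 ∈ P
      have e' : fromBlocks (0 : Matrix l l K) (single a b (1 : K) - single b a 1) 0 (0 : Matrix l l K) =
          single (inl a) (inr b) (1 : K) - single (inl b) (inr a) 1 := by
        rw [SymplecticSimple.single_inl_inr, SymplecticSimple.single_inl_inr, sub_eq_add_neg, sub_eq_add_neg,
          fromBlocks_neg, fromBlocks_add]
        simp
      rw [e']
      exact hN a b
    refine hPsmul h2 ?_
    have e2 : (2 : K) • fromBlocks (0 : Matrix l l K) X.toBlocks₁₂ 0 0 = L (X.toBlocks₁₂ - X.toBlocks₁₂ᵀ) := by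
      rw [hBB, sub_neg_eq_add, ← two_smul K X.toBlocks₁₂, map_smul]
      rfl
    rw [e2, OrthogonalSimpleTypeD.sub_transpose_eq_sum_smul, map_sum]
    refine P.sum_mem fun a _ => ?_
    rw [map_sum]
    refine P.sum_mem fun b _ => ?_
    rw [map_smul]
    exact P.smul_mem _ (hL a b)
  · -- the block `C`: `2(0 0; C 0) = Σ C_{ab} p_{ab}`
    let L : Matrix l l K →ₗ[K] Matrix (l ⊕ l) (l ⊕ l) K :=
      { toFun := fun x => fromBlocks 0 0 x 0
        map_add' := fun x y => by rw [fromBlocks_add, add_zero]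
        map_smul' := fun c x => by rw [RingHom.id_apply, fromBlocks_smul, smul_zero] }
    have hL : ∀ a b : l, L (single a b (1 : K) - single b a 1) ∈ P := by
      intro a b
      change fromBlocks 0 0 (single a b (1 : K) - single b a 1) 0 ∈ P
      have e' : fromBlocks (0 : Matrix l l K) 0 (single a b (1 : K) - single b a 1) (0 : Matrix l l K) =
          single (inr a) (inl b) (1 : K) - single (inr b) (inl a) 1 := by
        rw [SymplecticSimple.single_inr_inl, SymplecticSimple.single_inr_inl, sub_eq_add_neg, sub_eq_add_neg,
          fromBlocks_neg, fromBlocks_add]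
        simp
      rw [e']
      exact hV a b
    refine hPsmul h2 ?_
    have e2 : (2 : K) • fromBlocks (0 : Matrix l l K) 0 X.toBlocks₂₁ 0 = L (X.toBlocks₂₁ - X.toBlocks₂₁ᵀ) := by
      rw [hCC, sub_neg_eq_add, ← two_smul K X.toBlocks₂₁, map_smul]
      rfl
    rw [e2, OrthogonalSimpleTypeD.sub_transpose_eq_sum_smul, map_sum]
    refine P.sum_mem fun a _ => ?_
    rw [map_sum]
    refine P.sum_mem fun b _ => ?_
    rw [map_smul]
    exact P.smul_mem _ (hL a b)

/-- **Generation**: if `P` is stable under `ad 𝔰𝔭(2l)` (`2 ≠ 0`) and contains ONE unit `n_{cd}` with `c ≠ d` (a weight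
vector `ε_c + ε_d` of `Λ²`; `n_{12}` is the maximal vector), then `P` contains every traceless `J`-self-adjoint matrix:
`[m(E_{xc}), n_{cd}] = n_{xd}` (rows A1-168's table), `[E_{a'a}, n_{ab}] = E_{ba} + E_{a'b'}`,
`[E_{b'b}, E_{ba} + E_{a'b'}] = -p_{ab}`, `[E_{a'b} + E_{b'a}, n_{ab}] = -(d_a - d_b)`, then `mem_of_forall_units_mem`.
[cite: Humphreys1972, §1.2, §20.2 (a maximal vector generates)] [cite: LooijengaLunts1997, Appendix (7.5), p. 28 L89] -/
theorem mem_of_nsub_mem (h2 : (2 : K) ≠ 0)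
    (hP : ∀ ⦃Y m : Matrix (l ⊕ l) (l ⊕ l) K⦄, Y ∈ sp l K → m ∈ P → Y * m - m * Y ∈ P)
    {c d : l} (hcd : c ≠ d) (hn : single (inl c) (inr d) (1 : K) - single (inl d) (inr c) 1 ∈ P)
    {X : Matrix (l ⊕ l) (l ⊕ l) K} (hX : (Matrix.J l K).IsSelfAdjoint X) (htr : Matrix.trace X = 0) : X ∈ P := by
  -- all `n_{uv}` (as in `OrthogonalSimpleTypeD.mem_of_nsub_mem`, the `m(E_{uv})` being common to `𝔬(2l)` and `𝔰𝔭(2l)`)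
  have hn1 : ∀ x : l, single (inl x) (inr d) (1 : K) - single (inl d) (inr x) 1 ∈ P := by
    intro x
    have h := hP (SymplecticSimple.single_inl_inl_sub_single_inr_inr_mem_sp (R := K) x c) hn
    rwa [OrthogonalSimpleTypeD.msub_comm_nsub x hcd] at h
  have hN : ∀ u v : l, single (inl u) (inr v) (1 : K) - single (inl v) (inr u) 1 ∈ P := by
    intro u v
    by_cases hvd : v = d
    · subst hvd; exact hn1 u
    · have hdv : single (inl d) (inr v) (1 : K) - single (inl v) (inr d) 1 ∈ P := by
        have h := P.neg_mem (hn1 v)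
        rwa [neg_sub] at h
      have h := hP (SymplecticSimple.single_inl_inl_sub_single_inr_inr_mem_sp (R := K) u d) hdv
      rwa [OrthogonalSimpleTypeD.msub_comm_nsub u (Ne.symm hvd)] at h
  -- all `E_{ab} + E_{b'a'}`, `a ≠ b`
  have hQ : ∀ a b : l, a ≠ b → single (inl a) (inl b) (1 : K) + single (inr b) (inr a) 1 ∈ P := by
    intro a b hab
    have h := hP (SymplecticSimple.single_inr_inl_mem_sp (R := K) b) (hN b a)
    rwa [single_inr_inl_comm_nsub (Ne.symm hab)] at h
  -- all `p_{ab}`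
  have hV : ∀ a b : l, single (inr a) (inl b) (1 : K) - single (inr b) (inl a) 1 ∈ P := by
    intro a b
    by_cases hab : a = b
    · subst hab; rw [sub_self]; exact P.zero_mem
    · have h := hP (SymplecticSimple.single_inr_inl_mem_sp (R := K) b) (hQ b a (Ne.symm hab))
      rw [single_inr_inl_comm_qsub, P.neg_mem_iff] at h
      exact h
  -- all `d_a - d_b`
  have hD : ∀ a b : l, (single (inl a) (inl a) (1 : K) + single (inr a) (inr a) 1)
      - (single (inl b) (inl b) (1 : K) + single (inr b) (inr b) 1) ∈ P := by
    intro a b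
    by_cases hab : a = b
    · rw [hab, sub_self]; exact P.zero_mem
    · have h := hP (SymplecticSimple.single_inr_inl_add_mem_sp (R := K) a b) (hN a b)
      rw [padd_comm_nsub hab, P.neg_mem_iff] at h
      exact h
  exact mem_of_forall_units_mem h2 hQ hD hN hV hX htr

/-- **The elementary core**: for `2 ≠ 0` and `|l| ≠ 0` in `K`, a `K`-subspace `P` of TRACELESS `J`-SELF-ADJOINT matrices
stable under `m ↦ Ym - mY` for all `Y ∈ 𝔰𝔭(2l, K)` is `0` or contains every traceless `J`-self-adjoint matrix: the
summand `𝔤_+(U) ≅ Λ²₀U` of Looijenga–Lunts (7.5) is irreducible under `𝔞𝔲𝔱(U) = 𝔰𝔭(U)` for a symplectic `U`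
(`dim U = 2|l|`; for `|l| = 1`, `𝔤_+(U) = 0`, cf. `GlSelfAdjointDecomposition.lean` §8).  The hypothesis `|l| ≠ 0` in `K`
is necessary: for `char K ∣ |l|` the identity is traceless and spans a stable line. [cite: LooijengaLunts1997, Appendix (7.5), p. 28 L89 ("The summands are irreducible")] [cite: Humphreys1972, §19.2, §20.1–§20.2] -/
theorem eq_bot_or_forall_mem_of_forall_comm_mem (h2 : (2 : K) ≠ 0) (hl : ((Fintype.card l : ℕ) : K) ≠ 0)
    (hP : ∀ ⦃Y m : Matrix (l ⊕ l) (l ⊕ l) K⦄, Y ∈ sp l K → m ∈ P → Y * m - m * Y ∈ P)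
    (hPS : ∀ ⦃m : Matrix (l ⊕ l) (l ⊕ l) K⦄, m ∈ P → (Matrix.J l K).IsSelfAdjoint m)
    (hPT : ∀ ⦃m : Matrix (l ⊕ l) (l ⊕ l) K⦄, m ∈ P → Matrix.trace m = 0) :
    P = ⊥ ∨ ∀ ⦃X : Matrix (l ⊕ l) (l ⊕ l) K⦄, (Matrix.J l K).IsSelfAdjoint X → Matrix.trace X = 0 → X ∈ P := by
  by_cases hbot : P = ⊥
  · exact Or.inl hbot
  right
  obtain ⟨X, hXP, hX0⟩ := (Submodule.ne_bot_iff P).1 hbot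
  obtain ⟨c, d, hcd, hn⟩ := exists_nsub_mem_of_ne_zero h2 hl hP hPS hPT hXP hX0
  intro Y hY hYtr
  exact mem_of_nsub_mem h2 hP hcd hn hY hYtr

end stable

/-! ### §6 `Λ²₀` is an irreducible `𝔰𝔭(2l)`-module: the subspace statement -/

/-- Membership in `𝔤_+ = sym_J ∩ 𝔰𝔩`. [cite: LooijengaLunts1997, Appendix (7.5), p. 28 L80–L84] -/
theorem mem_selfAdjoint_inf_ker_trace_iff (X : Matrix (l ⊕ l) (l ⊕ l) K) :
    X ∈ selfAdjointMatricesSubmodule (Matrix.J l K) ⊓ LinearMap.ker (Matrix.traceLinearMap (l ⊕ l) K K)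
      ↔ (Matrix.J l K).IsSelfAdjoint X ∧ Matrix.trace X = 0 := by
  rw [Submodule.mem_inf, mem_selfAdjointMatricesSubmodule, LinearMap.mem_ker, Matrix.traceLinearMap_apply]

/-- **Looijenga–Lunts (7.5), "the summands are irreducible" — the summand `𝔤_+(U)` for a SYMPLECTIC `U`, in matrices**:
for `J = (0 -I; I 0)` of size `2|l|`, `2 ≠ 0` and `|l| ≠ 0` in `K`, every `K`-subspace `P ⊆ 𝔤_+ = {X : XᵀJ = JX, tr X = 0}`
stable under `X ↦ [A, X] = AX - XA` for all `A ∈ 𝔰𝔭(2l, K) = sp l K` is `⊥` or all of `𝔤_+`.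
[cite: LooijengaLunts1997, Appendix (7.5), p. 28 L86–L90] [cite: Humphreys1972, §19.2, §20.1–§20.2] -/
theorem eq_bot_or_eq_of_forall_comm_mem (h2 : (2 : K) ≠ 0) (hl : ((Fintype.card l : ℕ) : K) ≠ 0)
    {P : Submodule K (Matrix (l ⊕ l) (l ⊕ l) K)}
    (hle : P ≤ selfAdjointMatricesSubmodule (Matrix.J l K) ⊓ LinearMap.ker (Matrix.traceLinearMap (l ⊕ l) K K))
    (hP : ∀ A ∈ sp l K, ∀ X ∈ P, A * X - X * A ∈ P) :
    P = ⊥ ∨ P = selfAdjointMatricesSubmodule (Matrix.J l K) ⊓ LinearMap.ker (Matrix.traceLinearMap (l ⊕ l) K K) := by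
  have hPS : ∀ ⦃m : Matrix (l ⊕ l) (l ⊕ l) K⦄, m ∈ P → (Matrix.J l K).IsSelfAdjoint m :=
    fun m hm => ((mem_selfAdjoint_inf_ker_trace_iff m).1 (hle hm)).1
  have hPT : ∀ ⦃m : Matrix (l ⊕ l) (l ⊕ l) K⦄, m ∈ P → Matrix.trace m = 0 :=
    fun m hm => ((mem_selfAdjoint_inf_ker_trace_iff m).1 (hle hm)).2
  rcases eq_bot_or_forall_mem_of_forall_comm_mem h2 hl (fun Y m hY hm => hP Y hY m hm) hPS hPT with h | h
  · exact Or.inl h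
  · right
    refine le_antisymm hle fun X hX => ?_
    obtain ⟨hXs, hXt⟩ := (mem_selfAdjoint_inf_ker_trace_iff X).1 hX
    exact h hXs hXt

/-- The same in characteristic `0` (`l` non-empty). [cite: LooijengaLunts1997, Appendix (7.5), p. 28 L86–L90] -/
theorem eq_bot_or_eq_of_forall_comm_mem_of_charZero [CharZero K] [Nonempty l]
    {P : Submodule K (Matrix (l ⊕ l) (l ⊕ l) K)}
    (hle : P ≤ selfAdjointMatricesSubmodule (Matrix.J l K) ⊓ LinearMap.ker (Matrix.traceLinearMap (l ⊕ l) K K))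
    (hP : ∀ A ∈ sp l K, ∀ X ∈ P, A * X - X * A ∈ P) :
    P = ⊥ ∨ P = selfAdjointMatricesSubmodule (Matrix.J l K) ⊓ LinearMap.ker (Matrix.traceLinearMap (l ⊕ l) K K) :=
  eq_bot_or_eq_of_forall_comm_mem two_ne_zero (Nat.cast_ne_zero.2 Fintype.card_ne_zero) hle hP

/-- `𝔤_+ ≠ 0` as soon as `|l| ≥ 2`: `n_{ab} ∈ 𝔤_+` and `n_{ab} ≠ 0` for `a ≠ b`. [cite: LooijengaLunts1997, Appendix (7.5), p. 28] -/
theorem nsub_mem_selfAdjoint_inf_ker_trace {a b : l} (hab : a ≠ b) :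
    single (inl a) (inr b) (1 : K) - single (inl b) (inr a) 1
        ∈ selfAdjointMatricesSubmodule (Matrix.J l K) ⊓ LinearMap.ker (Matrix.traceLinearMap (l ⊕ l) K K)
      ∧ (single (inl a) (inr b) (1 : K) - single (inl b) (inr a) 1 : Matrix (l ⊕ l) (l ⊕ l) K) ≠ 0 := by
  refine ⟨(mem_selfAdjoint_inf_ker_trace_iff _).2 ⟨nsub_isSelfAdjoint a b, ?_⟩, fun h => ?_⟩
  · rw [Matrix.trace_sub, Matrix.trace_single_eq_of_ne _ _ _ inl_ne_inr, Matrix.trace_single_eq_of_ne _ _ _ inl_ne_inr,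
      sub_zero]
  · have hba : (inl b : l ⊕ l) ≠ inl a := fun h' => hab (inl_injective h').symm
    have := congrFun (congrFun h (inl a)) (inr b)
    rw [Matrix.sub_apply, single_apply_same, single_apply_of_row_ne hba, Matrix.zero_apply, sub_zero] at this
    exact one_ne_zero this

/-! ### §7 Basis-free: `𝔤_+(U) = sym_B(U) ∩ 𝔰𝔩(U)` is `ad(𝔰𝔭(U, B))`-irreducible for EVERY symplectic space (Darboux basis) -/

section Transport

variable {V : Type*} [AddCommGroup V] [Module K V] [FiniteDimensional K V] {B : LinearMap.BilinForm K V}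

open Module in
/-- **Looijenga–Lunts (7.5), "the summands are irreducible" — `𝔤_+(U)`, SYMPLECTIC `U`, basis-free over any field with
`2 ≠ 0` and `dim U ≠ 0` in `K`** (so `char K ∤ dim U`; e.g. `ℚ`, `ℝ`, `ℂ`): for a non-degenerate alternating `B`, every
`K`-subspace `P ⊆ 𝔤_+(U) = B.selfAdjointSubmodule ⊓ ker tr` stable under all `X ↦ [a, X]`, `a ∈ 𝔰𝔭(U, B) = B.skewAdjointSubmodule`,
is `⊥` or `𝔤_+(U)` — transported from the matrix core through a Darboux basis (`exists_symplecticBasis`, Gram matrix `-J`)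
with row A1-175's `OrthogonalSelfAdjointTypeD.eq_bot_or_eq_of_core`. [cite: LooijengaLunts1997, Appendix (7.5), p. 28 L86–L90] [cite: Humphreys1972, §19.2 (type C_ℓ), §20.1–§20.2] -/
theorem eq_bot_or_eq_of_forall_lie_mem [NeZero (2 : K)] (hBa : B.IsAlt) (hB : B.Nondegenerate)
    (hV : ((finrank K V : ℕ) : K) ≠ 0)
    {P : Submodule K (Module.End K V)} (hP : P ≤ B.selfAdjointSubmodule ⊓ LinearMap.ker (LinearMap.trace K V))
    (hstab : ∀ a ∈ B.skewAdjointSubmodule, ∀ x ∈ P, ⁅a, x⁆ ∈ P) :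
    P = ⊥ ∨ P = B.selfAdjointSubmodule ⊓ LinearMap.ker (LinearMap.trace K V) := by
  classical
  obtain ⟨ι, _, _, b, h11, h22, h12, h21⟩ := Literature.LinearAlgebra.Alternating.exists_symplecticBasis hBa hB
  have hG := SymplecticAlgebraSimple.toMatrix_eq_neg_J_of_darboux b B h11 h22 h12 h21
  have hι : ((Fintype.card ι : ℕ) : K) ≠ 0 := by
    rw [finrank_eq_card_basis b, Fintype.card_sum, ← two_mul, Nat.cast_mul, Nat.cast_two] at hV
    exact (mul_ne_zero_iff.1 hV).2
  refine OrthogonalSelfAdjointTypeD.eq_bot_or_eq_of_core b (fun P' hst hsa htr ↦ ?_) hP hstab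
  rw [hG] at hst hsa ⊢
  simp only [isSelfAdjoint_neg_J_iff] at hsa ⊢
  exact eq_bot_or_forall_mem_of_forall_comm_mem (P := P') (NeZero.ne 2) hι
    (fun Y n hY hn ↦ hst ((SymplecticAlgebraSimple.isSkewAdjoint_neg_J_iff_mem_sp Y).2 hY) hn) hsa htr

open Module in
/-- The same in characteristic `0` (`V ≠ 0`). [cite: LooijengaLunts1997, Appendix (7.5), p. 28 L86–L90] -/
theorem eq_bot_or_eq_of_forall_lie_mem_of_charZero [CharZero K] [Nontrivial V] (hBa : B.IsAlt) (hB : B.Nondegenerate)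
    {P : Submodule K (Module.End K V)} (hP : P ≤ B.selfAdjointSubmodule ⊓ LinearMap.ker (LinearMap.trace K V))
    (hstab : ∀ a ∈ B.skewAdjointSubmodule, ∀ x ∈ P, ⁅a, x⁆ ∈ P) :
    P = ⊥ ∨ P = B.selfAdjointSubmodule ⊓ LinearMap.ker (LinearMap.trace K V) :=
  eq_bot_or_eq_of_forall_lie_mem hBa hB (Nat.cast_ne_zero.2 finrank_pos.ne') hP hstab

end Transport

end Literature.Algebra.Lie.SymplecticSelfAdjoint
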